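import Summits.AtomisticToContinuum.HydrodynamicLimit.Theorems.InformationPercolationEngineChaosClosesEulerStressIsotropyF
import Summits.AtomisticToContinuum.HydrodynamicLimit.Theorems.InformationPercolationEngineChaosClosesEulerLocalEquilibriumFromDissipationA
import Literature.Analysis.FluidPDE.EmpiricalCollisionMeasure
import Literature.Analysis.FluidPDE.HardSphereRegularGeometry
import HarnessLib

/-!
# Window covariance isotropy (crux `JParityClosure.ParityBandClosure`, stmt-AtomisticToContinuum-17608, line
# `transfer-weighted-parity-chain`, stub `stub_windowCovarianceIsotropy`) — helper A: the window law and the window record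

WHAT.  The finite-`N` DICTIONARY objects of the stub, for ONE configuration path `γ : ℝ → Config (N+1) (Fin 3) 𝕋³`
and ONE space–time window at `(t₀, x₀)` (tent in time of width `r²`, cone in space of width `r`, horizon `[0, τ]`):

* `btent r a = (r²)⁻¹ (1 − |a|/r²)₊` — the time window; bounds, Lipschitz bound, continuity;
* `wlaw r τ t₀ x₀ γ` — the UN-normalised window law `λ_w` on `ℝ³`:
  `∫ f dλ_w = ∫_{s ∈ [0,τ]} btent(s − t₀) ∫ cone(q.1, x₀) f(q.2) dμ_{γ s} ds` (`integral_wlaw`), a finite measure carried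
  by the velocities of the path (`wlaw_compl_ball_eq_zero`), built as the sum over particles of the push-forwards of
  `btent · cone/(N+1) ds` under `s ↦ vₖ(s)`;
* `toSph`, `wrec ε r τ t₀ x₀ γ` — the window record `κ_w` on `Q = (ℝ³ × ℝ³) × S²`: the `btent · cone`-weighted,
  `ε/(N+1)`-normalised collision sum of Dirac masses at `((vᵢ⁻, vⱼ⁻), ε⁻¹(xᵢ − xⱼ))` over the collisions in `[0, τ]`
  (`integral_wrec`: `∫ F dκ_w = ε/(N+1) · collisionPairSum … (btent · cone · F)` — the inline `Kc`-form of the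
  pointwise kinetic inputs after `collisionPairSum_eq_finsum_ite`); every function is integrable against it.

REFERENCES.  M. Pulvirenti, S. Simonella, *On the evolution of the empirical measure for the hard-sphere dynamics*,
Bull. Inst. Math. Acad. Sin. 10 (2015) §3 (collision sums of one trajectory); H. Spohn, *Large Scale Dynamics of
Interacting Particles* (1991), Part I §3.  No named fact is invoked.
-/

noncomputable section

namespace Summit.AtomisticToContinuum.HydrodynamicLimit.Theorems.ParityBandClosureWindowCovariance

open scoped BigOperators Topology Classical MeasureTheory ENNReal InnerProductSpace
open Filter Set MeasureTheory Function
open Literature.MathematicalPhysics.KineticTheory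
open Literature.Analysis.FluidPDE
open Summit.AtomisticToContinuum.HydrodynamicLimit.Theorems.LocalSecondLawNegative (cone cone_nonneg cone_le
  continuous_cone integral_cone_le)

variable {N : ℕ}

/-! ## §1 The time tent -/

/-- The time window `btent r a = (r²)⁻¹ (1 − |a|/r²)₊` (unit mass, support `[−r², r²]`). [folklore] -/
def btent (r a : ℝ) : ℝ := (r ^ 2)⁻¹ * max (1 - |a| / r ^ 2) 0

/-- The tent is nonnegative. [folklore] -/
theorem btent_nonneg (r a : ℝ) : 0 ≤ btent r a := by
  unfold btent; positivity

/-- The tent is at most its height `(r²)⁻¹`. [folklore] -/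
theorem btent_le (r a : ℝ) : btent r a ≤ (r ^ 2)⁻¹ := by
  unfold btent
  refine mul_le_of_le_one_right (by positivity) (max_le ?_ zero_le_one)
  linarith [div_nonneg (abs_nonneg a) (sq_nonneg r)]

/-- The tent vanishes outside `(−r², r²)`. [folklore] -/
theorem btent_eq_zero {r a : ℝ} (hr : 0 < r) (ha : r ^ 2 ≤ |a|) : btent r a = 0 := by
  unfold btent
  have h : 1 - |a| / r ^ 2 ≤ 0 := by
    rw [sub_nonpos, le_div_iff₀ (by positivity), one_mul]; exact ha
  rw [max_eq_right h, mul_zero]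

/-- The tent is continuous. [folklore] -/
theorem continuous_btent (r : ℝ) : Continuous (btent r) := by
  unfold btent; fun_prop

/-- The tent is `(r²)⁻²`-Lipschitz. [folklore] -/
theorem abs_btent_sub_le {r : ℝ} (hr : 0 < r) (a b : ℝ) : |btent r a - btent r b| ≤ (r ^ 2)⁻¹ * (r ^ 2)⁻¹ * |a - b| := by
  unfold btent
  rw [← mul_sub, abs_mul, abs_of_pos (by positivity : (0 : ℝ) < (r ^ 2)⁻¹), mul_assoc]
  refine mul_le_mul_of_nonneg_left ?_ (by positivity)
  have h1 : |max (1 - |a| / r ^ 2) 0 - max (1 - |b| / r ^ 2) 0| ≤ |(1 - |a| / r ^ 2) - (1 - |b| / r ^ 2)| :=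
    abs_max_sub_max_le_abs _ _ _
  refine h1.trans ?_
  rw [sub_sub_sub_cancel_left, ← sub_div, abs_div, abs_of_pos (by positivity : (0 : ℝ) < r ^ 2),
    div_eq_inv_mul]
  exact mul_le_mul_of_nonneg_left (abs_abs_sub_abs_le_abs_sub b a |>.trans_eq (abs_sub_comm b a)) (by positivity)

/-! ## §2 The window law -/

/-- The window weight of particle `k` at time `s`: `btent(s − t₀) · cone(xₖ(s), x₀)/(N+1)`. [folklore] -/
def wwt (r t₀ : ℝ) (x₀ : T3) (γ : ℝ → Config (N + 1) (Fin 3) T3) (s : ℝ) (k : Fin (N + 1)) : ℝ :=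
  btent r (s - t₀) * (((N + 1 : ℕ) : ℝ)⁻¹ * cone r (γ s k).1 x₀)

/-- **The window law** `λ_w` on `ℝ³` of the path `γ` at the window `(t₀, x₀)`: the sum over particles of the
push-forwards of `wwt ds|_{[0,τ]}` under `s ↦ vₖ(s)`. [folklore] -/
def wlaw (r τ t₀ : ℝ) (x₀ : T3) (γ : ℝ → Config (N + 1) (Fin 3) T3) : Measure V3 :=
  ∑ k : Fin (N + 1), ((volume.restrict (Set.Icc 0 τ)).withDensity
    (fun s => ENNReal.ofReal (wwt r t₀ x₀ γ s k))).map (fun s => (γ s k).2)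

section WLaw

variable {r τ t₀ : ℝ} {x₀ : T3} {γ : ℝ → Config (N + 1) (Fin 3) T3}

/-- The window weight is nonnegative. [folklore] -/
theorem wwt_nonneg (hr : 0 < r) (t₀ : ℝ) (x₀ : T3) (γ : ℝ → Config (N + 1) (Fin 3) T3) (s : ℝ) (k : Fin (N + 1)) :
    0 ≤ wwt r t₀ x₀ γ s k :=
  mul_nonneg (btent_nonneg _ _) (mul_nonneg (by positivity) (cone_nonneg hr _ _))

/-- The window weight is at most `(r²)⁻¹ · 3/(πr³)/(N+1)`. [folklore] -/
theorem wwt_le (hr : 0 < r) (t₀ : ℝ) (x₀ : T3) (γ : ℝ → Config (N + 1) (Fin 3) T3) (s : ℝ) (k : Fin (N + 1)) :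
    wwt r t₀ x₀ γ s k ≤ (r ^ 2)⁻¹ * (((N + 1 : ℕ) : ℝ)⁻¹ * (3 / (Real.pi * r ^ 3))) := by
  unfold wwt
  refine mul_le_mul (btent_le _ _) (mul_le_mul_of_nonneg_left ?_ (by positivity))
    (mul_nonneg (by positivity) (cone_nonneg hr _ _)) (by positivity)
  have h := cone_le hr (γ s k).1 x₀
  refine h.trans (mul_le_of_le_one_right (by positivity) ?_)
  by_cases hx : x₀ ∈ {x : T3 | Torus.euclidDist x (γ s k).1 < r}
  · rw [Set.indicator_of_mem hx]
  · rw [Set.indicator_of_notMem hx]; exact zero_le_one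

/-- The cone kernel read at a measurable position is measurable (in any parameter space). [folklore] -/
theorem measurable_cone_comp {α : Type*} [MeasurableSpace α] (r : ℝ) {f g : α → T3} (hf : Measurable f)
    (hg : Measurable g) : Measurable fun a => cone r (f a) (g a) := by
  have h := (ChaosClosesEulerLocalEquilibriumFromDissipation.continuous_cone_uncurry' r).measurable.comp (hf.prodMk hg)
  exact h

/-- The window weight is measurable in time along a measurable path. [folklore] -/
theorem measurable_wwt (hγ : Measurable γ) (r t₀ : ℝ) (x₀ : T3) (k : Fin (N + 1)) :
    Measurable fun s => wwt r t₀ x₀ γ s k := by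
  have hk : Measurable fun s : ℝ => (γ s k).1 := ((measurable_pi_apply k).comp hγ).fst
  have h1 : Measurable fun s : ℝ => btent r (s - t₀) :=
    (continuous_btent r).measurable.comp (measurable_id.sub measurable_const)
  have h2 : Measurable fun s : ℝ => cone r (γ s k).1 x₀ := measurable_cone_comp r hk measurable_const
  exact h1.mul (measurable_const.mul h2)

/-- **Integration against the window law.**  For a measurable `f` bounded along the velocities of the path,
`∫ f dλ_w = ∫_{s ∈ [0,τ]} btent(s − t₀) ∫ cone(q.1, x₀) f(q.2) dμ_{γ s} ds`. [folklore] -/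
theorem integral_wlaw (hr : 0 < r) (hγ : Measurable γ) {f : V3 → ℝ} (hf : Measurable f) {C : ℝ}
    (hC : ∀ s k, |f (γ s k).2| ≤ C) :
    ∫ v, f v ∂(wlaw r τ t₀ x₀ γ) =
      ∫ s in Set.Icc 0 τ, btent r (s - t₀) * ∫ q, cone r q.1 x₀ * f q.2 ∂(empiricalMeasure (γ s)) := by
  have hvk : ∀ k : Fin (N + 1), Measurable fun s : ℝ => (γ s k).2 := fun k => ((measurable_pi_apply k).comp hγ).snd
  have hden : ∀ k : Fin (N + 1), Measurable fun s => ENNReal.ofReal (wwt r t₀ x₀ γ s k) := fun k =>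
    ENNReal.measurable_ofReal.comp (measurable_wwt hγ r t₀ x₀ k)
  -- each particle
  have hk : ∀ k : Fin (N + 1),
      ∫ v, f v ∂(((volume.restrict (Set.Icc 0 τ)).withDensity
        (fun s => ENNReal.ofReal (wwt r t₀ x₀ γ s k))).map (fun s => (γ s k).2)) =
      ∫ s in Set.Icc 0 τ, wwt r t₀ x₀ γ s k * f (γ s k).2 := by
    intro k
    rw [integral_map (hvk k).aemeasurable hf.aestronglyMeasurable,
      integral_withDensity_eq_integral_toReal_smul (hden k) (Eventually.of_forall fun _ => ENNReal.ofReal_lt_top)]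
    refine integral_congr_ae (Eventually.of_forall fun s => ?_)
    simp only [ENNReal.toReal_ofReal (wwt_nonneg hr t₀ x₀ γ s k), smul_eq_mul]
  -- integrability of each term on the window
  have hint : ∀ k : Fin (N + 1), Integrable (fun s => wwt r t₀ x₀ γ s k * f (γ s k).2) (volume.restrict (Set.Icc 0 τ)) := by
    intro k
    refine Measure.integrableOn_of_bounded (M := (r ^ 2)⁻¹ * (((N + 1 : ℕ) : ℝ)⁻¹ * (3 / (Real.pi * r ^ 3))) * C) ?_
      (((measurable_wwt hγ r t₀ x₀ k).mul (hf.comp (hvk k))).aestronglyMeasurable) (ae_of_all _ fun s => ?_)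
    · rw [Real.volume_Icc]; exact ENNReal.ofReal_ne_top
    · rw [norm_mul, Real.norm_eq_abs, Real.norm_eq_abs, abs_of_nonneg (wwt_nonneg hr t₀ x₀ γ s k)]
      exact mul_le_mul (wwt_le hr t₀ x₀ γ s k) (hC s k) (abs_nonneg _)
        ((wwt_nonneg hr t₀ x₀ γ s k).trans (wwt_le hr t₀ x₀ γ s k))
  have hpt : (fun s => ∑ k, wwt r t₀ x₀ γ s k * f (γ s k).2) =
      fun s => btent r (s - t₀) * ∫ q, cone r q.1 x₀ * f q.2 ∂(empiricalMeasure (γ s)) := by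
    funext s
    rw [integral_empiricalMeasure, Finset.mul_sum, Finset.mul_sum]
    refine Finset.sum_congr rfl fun k _ => ?_
    unfold wwt; ring
  unfold wlaw
  rw [integral_finsetSum_measure fun k _ => ?_]
  · simp_rw [hk]
    rw [← integral_finsetSum _ fun k _ => hint k, hpt]
  · rw [integrable_map_measure hf.aestronglyMeasurable (hvk k).aemeasurable]
    refine (integrable_withDensity_iff_integrable_smul₀' (hden k).aemeasurable
      (Eventually.of_forall fun _ => ENNReal.ofReal_lt_top)).2 ?_
    refine (hint k).congr (Eventually.of_forall fun s => ?_)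
    simp only [Function.comp_apply, ENNReal.toReal_ofReal (wwt_nonneg hr t₀ x₀ γ s k), smul_eq_mul]

/-- The window law gives no mass to a measurable set avoided by all velocities of the path. [folklore] -/
theorem wlaw_apply_eq_zero (hγ : Measurable γ) {S : Set V3} (hS : MeasurableSet S) (h : ∀ s k, (γ s k).2 ∉ S) :
    wlaw r τ t₀ x₀ γ S = 0 := by
  have hvk : ∀ k : Fin (N + 1), Measurable fun s : ℝ => (γ s k).2 := fun k => ((measurable_pi_apply k).comp hγ).snd
  unfold wlaw
  rw [Measure.coe_finsetSum, Finset.sum_apply]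
  refine Finset.sum_eq_zero fun k _ => ?_
  rw [Measure.map_apply (hvk k) hS]
  have he : (fun s => (γ s k).2) ⁻¹' S = ∅ := Set.eq_empty_iff_forall_notMem.2 fun s hs => h s k hs
  rw [he, measure_empty]

/-- The window law is a finite measure. [folklore] -/
theorem isFiniteMeasure_wlaw (hr : 0 < r) : IsFiniteMeasure (wlaw r τ t₀ x₀ γ) := by
  have hfin : ∀ k : Fin (N + 1), IsFiniteMeasure (((volume.restrict (Set.Icc 0 τ)).withDensity
      (fun s => ENNReal.ofReal (wwt r t₀ x₀ γ s k))).map (fun s => (γ s k).2)) := by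
    intro k
    haveI : IsFiniteMeasure ((volume.restrict (Set.Icc 0 τ)).withDensity
        (fun s => ENNReal.ofReal (wwt r t₀ x₀ γ s k))) := by
      refine isFiniteMeasure_withDensity_ofReal ?_
      refine HasFiniteIntegral.of_bounded (C := (r ^ 2)⁻¹ * (((N + 1 : ℕ) : ℝ)⁻¹ * (3 / (Real.pi * r ^ 3)))) ?_
      refine ae_of_all _ fun s => ?_
      rw [Real.norm_eq_abs, abs_of_nonneg (wwt_nonneg hr t₀ x₀ γ s k)]
      exact wwt_le hr t₀ x₀ γ s k
    infer_instance
  refine ⟨?_⟩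
  unfold wlaw
  rw [Measure.coe_finsetSum, Finset.sum_apply]
  exact ENNReal.sum_lt_top.2 fun k _ => by haveI := hfin k; exact measure_lt_top _ _

/-- Along the window law, almost every velocity is a velocity of the path: a bound valid along the path holds
`λ_w`-a.e. [folklore] -/
theorem ae_wlaw_norm_le (hγ : Measurable γ) {R : ℝ} (hR : ∀ s k, ‖(γ s k).2‖ ≤ R) :
    ∀ᵐ v ∂(wlaw r τ t₀ x₀ γ), ‖v‖ ≤ R := by
  rw [ae_iff]
  have hS : MeasurableSet {v : V3 | ¬‖v‖ ≤ R} := (measurableSet_le measurable_norm measurable_const).compl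
  exact wlaw_apply_eq_zero hγ hS fun s k hsk => hsk (hR s k)

/-- A measurable function bounded on the velocity ball of the path is integrable against the window law.
[folklore] -/
theorem integrable_wlaw (hr : 0 < r) (hγ : Measurable γ) {R : ℝ} (hR : ∀ s k, ‖(γ s k).2‖ ≤ R) {f : V3 → ℝ}
    (hf : Measurable f) {C : ℝ} (hC : ∀ v, ‖v‖ ≤ R → |f v| ≤ C) : Integrable f (wlaw r τ t₀ x₀ γ) := by
  haveI := isFiniteMeasure_wlaw (N := N) (τ := τ) (t₀ := t₀) (x₀ := x₀) (γ := γ) hr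
  refine Integrable.mono' (integrable_const C) hf.aestronglyMeasurable ?_
  filter_upwards [ae_wlaw_norm_le (r := r) (τ := τ) (t₀ := t₀) (x₀ := x₀) hγ hR] with v hv
  rw [Real.norm_eq_abs]; exact hC v hv

/-- **The mass of the window law** is the window density `ρ_w = ∫ btent · ρ_r`. [folklore] -/
theorem wlaw_univ_toReal (hr : 0 < r) (hγ : Measurable γ) :
    ((wlaw r τ t₀ x₀ γ) Set.univ).toReal =
      ∫ s in Set.Icc 0 τ, btent r (s - t₀) * ∫ q, cone r q.1 x₀ ∂(empiricalMeasure (γ s)) := by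
  have h := integral_wlaw (τ := τ) (t₀ := t₀) (x₀ := x₀) hr hγ (f := fun _ => (1 : ℝ)) measurable_const
    (C := 1) (fun s k => by simp)
  simp only [mul_one, integral_const, smul_eq_mul, measureReal_def] at h
  exact h

end WLaw

/-! ## §3 The window record -/

/-- The point of `S²` carried by a unit vector (a fixed pole otherwise — junk, never met at a contact). [folklore] -/
def toSph (n : V3) : Metric.sphere (0 : V3) 1 :=
  if h : n ∈ Metric.sphere (0 : V3) 1 then ⟨n, h⟩
  else ⟨EuclideanSpace.single 0 1, by simp⟩

/-- On unit vectors `toSph` is the identity. [folklore] -/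
theorem coe_toSph {n : V3} (h : ‖n‖ = 1) : (toSph n : V3) = n := by
  have h' : n ∈ Metric.sphere (0 : V3) 1 := mem_sphere_zero_iff_norm.2 h
  unfold toSph
  rw [dif_pos h']

/-- `toSph` is measurable. [folklore] -/
theorem measurable_toSph : Measurable toSph := by
  unfold toSph
  exact Measurable.dite measurable_id measurable_const Metric.isClosed_sphere.measurableSet

/-- The record point of the ordered pair `(i, j)` of a configuration: pre-collisional velocities (by the
reflection involution) and the unit contact normal `ε⁻¹(xᵢ − xⱼ)`. [folklore] -/
def recPt (ε : ℝ) (w : Config (N + 1) (Fin 3) T3) (i j : Fin (N + 1)) : (V3 × V3) × Metric.sphere (0 : V3) 1 :=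
  (reflectVel ((Torus.geometry (Fin 3)).sepVec (w i).1 (w j).1) ((w i).2, (w j).2),
    toSph (ε⁻¹ • (Torus.geometry (Fin 3)).sepVec (w i).1 (w j).1))

/-- **The window record** `κ_w` on `Q = (ℝ³ × ℝ³) × S²`: the `ε/(N+1)`-normalised, `btent · cone`-weighted
collision sum of unit masses at the record points of the collisions of the path in `[0, τ]`. [folklore] -/
def wrec (ε r τ t₀ : ℝ) (x₀ : T3) (γ : ℝ → Config (N + 1) (Fin 3) T3) :
    Measure ((V3 × V3) × Metric.sphere (0 : V3) 1) :=
  collisionPairSum (Torus.geometry (Fin 3)) ε γ (Set.Icc 0 τ) fun s i j =>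
    (ε / (N + 1 : ℝ) * (btent r (s - t₀) * cone r (γ s i).1 x₀)).toNNReal • Measure.dirac (recPt ε (γ s) i j)

section WRec

variable {ε r τ t₀ : ℝ} {x₀ : T3} {γ : ℝ → Config (N + 1) (Fin 3) T3}

/-- The window record is a finite measure. [folklore] -/
theorem isFiniteMeasure_wrec (ε r τ t₀ : ℝ) (x₀ : T3) (γ : ℝ → Config (N + 1) (Fin 3) T3) :
    IsFiniteMeasure (wrec ε r τ t₀ x₀ γ) := by
  unfold wrec collisionPairSum
  refine finsum_mem_induction (fun μ => IsFiniteMeasure μ) (by infer_instance)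
    (fun μ ν hμ hν => by haveI := hμ; haveI := hν; infer_instance) fun _ _ => ?_
  exact Finset.sum_induction _ (fun μ => IsFiniteMeasure μ)
    (fun μ ν hμ hν => by haveI := hμ; haveI := hν; infer_instance) (by infer_instance)
    fun _ _ => inferInstance

/-- Every function is integrable against the window record (finitely many atoms, or zero). [folklore] -/
theorem integrable_wrec {E : Type*} [NormedAddCommGroup E] (f : (V3 × V3) × Metric.sphere (0 : V3) 1 → E) :
    Integrable f (wrec ε r τ t₀ x₀ γ) := by
  unfold wrec collisionPairSum
  refine finsum_mem_induction (fun μ => Integrable f μ) integrable_zero_measure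
    (fun _ _ hμ hν => hμ.add_measure hν) fun _ _ => ?_
  exact integrable_finsetSum_measure.2 fun _ _ => (integrable_dirac (by simp)).smul_measure ENNReal.coe_ne_top

/-- **Integration against the window record.**  On a path in the hard-sphere domain with finitely many collision
times in `[0, τ]`, for `ε ≥ 0`, `r > 0`:
`∫ F dκ_w = ε/(N+1) · Σ_{collisions (s,i,j)} btent(s − t₀) cone(xᵢ(s), x₀) F(record point)`. [folklore] -/
theorem integral_wrec {E : Type*} [NormedAddCommGroup E] [NormedSpace ℝ E] [CompleteSpace E] (hε : 0 ≤ ε)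
    (hr : 0 < r)
    (hfin : (collisionTimes (Torus.geometry (Fin 3)) ε γ ∩ Set.Icc 0 τ).Finite)
    (F : (V3 × V3) × Metric.sphere (0 : V3) 1 → E) :
    ∫ q, F q ∂(wrec ε r τ t₀ x₀ γ) =
      (ε / (N + 1 : ℝ)) • collisionPairSum (Torus.geometry (Fin 3)) ε γ (Set.Icc 0 τ)
        fun s i j => (btent r (s - t₀) * cone r (γ s i).1 x₀) • F (recPt ε (γ s) i j) := by
  have hint : ∀ (c : NNReal) (a : (V3 × V3) × Metric.sphere (0 : V3) 1), Integrable F (c • Measure.dirac a) :=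
    fun c a => (integrable_dirac (by simp)).smul_measure ENNReal.coe_ne_top
  unfold wrec
  rw [collisionPairSum_eq_finset_sum hfin, collisionPairSum_eq_finset_sum hfin,
    integral_finsetSum_measure fun t _ => integrable_finsetSum_measure.2 fun p _ => hint _ _, Finset.smul_sum]
  refine Finset.sum_congr rfl fun t _ => ?_
  rw [integral_finsetSum_measure fun p _ => hint _ _, Finset.smul_sum]
  refine Finset.sum_congr rfl fun p _ => ?_
  rw [integral_smul_nnreal_measure, integral_dirac, NNReal.smul_def,
    Real.coe_toNNReal _ (mul_nonneg (div_nonneg hε (by positivity))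
      (mul_nonneg (btent_nonneg _ _) (cone_nonneg hr _ _))), smul_smul]

/-- **The mass of the window record** is the weighted normalised collision count `K_w[1]`. [folklore] -/
theorem wrec_univ_toReal (hε : 0 ≤ ε) (hr : 0 < r)
    (hfin : (collisionTimes (Torus.geometry (Fin 3)) ε γ ∩ Set.Icc 0 τ).Finite) :
    ((wrec ε r τ t₀ x₀ γ) Set.univ).toReal =
      ε / (N + 1 : ℝ) * collisionPairSum (Torus.geometry (Fin 3)) ε γ (Set.Icc 0 τ)
        fun s i _ => btent r (s - t₀) * cone r (γ s i).1 x₀ := by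
  have h := integral_wrec (t₀ := t₀) (x₀ := x₀) hε hr hfin (fun _ => (1 : ℝ))
  simp only [integral_const, smul_eq_mul, mul_one, measureReal_def] at h
  exact h

end WRec

/-! ## §4 Along a hard-sphere trajectory -/

/-- On a hard-sphere trajectory every velocity is bounded by the (conserved) kinetic energy:
`‖vₖ(s)‖ ≤ √(2E(γ 0))`. [folklore] -/
theorem norm_vel_le_sqrt_of_isHardSphereTrajectory {ε : ℝ} {γ : ℝ → Config (N + 1) (Fin 3) T3}
    (hγ : IsHardSphereTrajectory (Torus.geometry (Fin 3)) ε (N + 1) γ) (s : ℝ) (k : Fin (N + 1)) :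
    ‖(γ s k).2‖ ≤ Real.sqrt (2 * configEnergy (γ 0)) := by
  have hE : configEnergy (γ s) = configEnergy (γ 0) := IsHardSphereTrajectory.configEnergy_eq_holds hγ s 0
  refine norm_vel_le_of_configEnergy_le (Real.sqrt_nonneg _) ?_ k
  have h0 : 0 ≤ configEnergy (γ 0) := by unfold configEnergy; positivity
  rw [Real.sq_sqrt (by positivity), hE]
  linarith

/-- On a hard-sphere trajectory the collision times in `[0, τ]` are finitely many. [folklore] -/
theorem finite_collisionTimes_Icc {ε : ℝ} {γ : ℝ → Config (N + 1) (Fin 3) T3}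
    (hγ : IsHardSphereTrajectory (Torus.geometry (Fin 3)) ε (N + 1) γ) (τ : ℝ) :
    (collisionTimes (Torus.geometry (Fin 3)) ε γ ∩ Set.Icc 0 τ).Finite :=
  hγ.locFinite 0 τ

/-- **Registered sub-goal `stub_wciTentLipschitz` (helper A of `stub_windowCovarianceIsotropy`): the time window
`a ↦ (r²)⁻¹(1 − |a|/r²)₊` of the pointwise kinetic inputs is `(r²)⁻²`-Lipschitz** (the modulus that makes the
per-window collisional balance defect `O(ε_N)` at fixed `r`). [folklore] -/
theorem stub_wciTentLipschitz : ∀ {r : ℝ}, 0 < r → ∀ a b : ℝ, |(r ^ 2)⁻¹ * max (1 - |a| / r ^ 2) 0 - (r ^ 2)⁻¹ * max (1 - |b| / r ^ 2) 0| ≤ (r ^ 2)⁻¹ * (r ^ 2)⁻¹ * |a - b| :=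
  fun hr a b => abs_btent_sub_le hr a b

end Summit.AtomisticToContinuum.HydrodynamicLimit.Theorems.ParityBandClosureWindowCovariance

end
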